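import Literature.NumberTheory.LFunctions.YoshidaWindowGramTailMSPrimeSums
import HarnessLib

/-!
# Kernel enclosures of Yoshida's matrix coefficients — VIII-e: certified sine lower-bound data for the mean-square tail

Source: H. Yoshida, Adv. Stud. Pure Math. **21** (1992) 281–325, §§6–7 [Yoshida1992HermitianForms].  The mean-square door
hypotheses `hs₁`/`hsm`/`hsp` (`0 ≤ s ≤ |sin(…)|` at the prime powers of the window) for the value-indexed data functions
`Encl.sFun sd cs`, `Encl.sFun2 sd cs` (part VIII-c), discharged by kernel checks: a box of `e^{iθ}` (`MC.expI`) at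
`θ = π ℓ_q/(2a)` resp. `θ = (π ℓ_q/a ∓ π ℓ_{q'}/a)/2` from the constants record, and the integer test
`sd·S ≤ min(|lo|,|hi|)·2^{cs}` on the sine component when it does not straddle `0` (a datum at a straddling box must be `0`).
Everything is proved; no named facts.
-/

open Real Complex Finset Matrix
open scoped BigOperators

namespace Literature.NumberTheory.LFunctions.Yoshida1992

open Literature.Analysis.SpecialFunctions Literature.Analysis.ValidatedNumerics.NumericsMP
open Literature.Analysis.ValidatedNumerics
open scoped ArithmeticFunction.vonMangoldt

namespace Encl

variable {S : ℕ} {a : ℝ} {ks : List PrimeLen} {C : Consts}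

/-- The datum test against a sine box `Y ∋ sin θ·S`: `z = 0`, or `Y` is one-signed and `z·2^{−cs} ≤ min |Y|/S`.
[cite: Moore1966, Ch. 3 (interval arithmetic: inclusion property)] -/
def sineDatumOK (S cs z : ℕ) (Y : MI) : Bool :=
  decide (z = 0) || ((decide (0 < Y.lo) && decide ((z : ℤ) * (S : ℤ) ≤ Y.lo * 2 ^ cs)) ||
    (decide (Y.hi < 0) && decide ((z : ℤ) * (S : ℤ) ≤ -Y.hi * 2 ^ cs)))

/-- [cite: Moore1966, Ch. 3 (interval arithmetic: inclusion property)] -/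
theorem sineDatum_le (hS : 0 < S) {cs z : ℕ} {Y : MI} {x : ℝ} (hx : MI.mem S x Y) (h : sineDatumOK S cs z Y = true) :
    0 ≤ ((z : ℕ) : ℝ) * (1 / 2 ^ cs) ∧ ((z : ℕ) : ℝ) * (1 / 2 ^ cs) ≤ |x| := by
  refine ⟨by positivity, ?_⟩
  have hSr : (0 : ℝ) < S := by exact_mod_cast hS
  have h2 : (0 : ℝ) < 2 ^ cs := by positivity
  obtain ⟨hlo, hhi⟩ := hx
  simp only [sineDatumOK, Bool.or_eq_true, Bool.and_eq_true, decide_eq_true_eq] at h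
  rcases h with hz | ⟨hpos, hle⟩ | ⟨hneg, hle⟩
  · subst hz; simp
  · have hle' : (z : ℝ) * S ≤ (Y.lo : ℝ) * 2 ^ cs := by exact_mod_cast hle
    have hxpos : (Y.lo : ℝ) ≤ x * S := hlo
    rw [mul_one_div, div_le_iff₀ h2]
    have : (z : ℝ) * S ≤ |x| * S * 2 ^ cs := by
      have h1 : (Y.lo : ℝ) * 2 ^ cs ≤ x * S * 2 ^ cs := by nlinarith
      have h3 : x * S * 2 ^ cs ≤ |x| * S * 2 ^ cs := by
        have hS2 : (0 : ℝ) ≤ S * 2 ^ cs := by positivity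
        have := mul_le_mul_of_nonneg_right (le_abs_self x) hS2
        linarith [this, show x * S * 2 ^ cs = x * (S * 2 ^ cs) by ring, show |x| * S * 2 ^ cs = |x| * (S * 2 ^ cs) by ring]
      linarith
    nlinarith
  · have hle' : (z : ℝ) * S ≤ -(Y.hi : ℝ) * 2 ^ cs := by exact_mod_cast hle
    have hxneg : x * S ≤ (Y.hi : ℝ) := hhi
    rw [mul_one_div, div_le_iff₀ h2]
    have : (z : ℝ) * S ≤ |x| * S * 2 ^ cs := by
      have h1 : -(Y.hi : ℝ) * 2 ^ cs ≤ -(x * S) * 2 ^ cs := by nlinarith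
      have h3 : -(x * S) * 2 ^ cs ≤ |x| * S * 2 ^ cs := by
        have hS2 : (0 : ℝ) ≤ S * 2 ^ cs := by positivity
        have := mul_le_mul_of_nonneg_right (neg_le_abs x) hS2
        linarith [this, show -(x * S) * 2 ^ cs = -x * (S * 2 ^ cs) by ring, show |x| * S * 2 ^ cs = |x| * (S * 2 ^ cs) by ring]
      linarith
    nlinarith

/-- The sine box at `θ`: imaginary part of `MC.expI`. [cite: Moore1966, Ch. 3 (interval arithmetic: inclusion property)] -/
def sinBox (prm : Params) (C : Consts) (Θ : MI) : Option MI := (MC.expI prm.S prm.Kser prm.kred C.P Θ).map MC.im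

/-- [cite: Moore1966, Ch. 3 (interval arithmetic: inclusion property)] -/
theorem mem_sinBox {prm : Params} (hS : 0 < prm.S) (hC : ConstsValid prm.S a ks C) {θ : ℝ} {Θ Y : MI}
    (hθ : MI.mem prm.S θ Θ) (h : sinBox prm C Θ = some Y) : MI.mem prm.S (Real.sin θ) Y := by
  unfold sinBox at h
  cases hE : MC.expI prm.S prm.Kser prm.kred C.P Θ with
  | none => simp [hE] at h
  | some Z =>
    simp only [hE, Option.map_some, Option.some.injEq] at h
    subst h
    have hm := (MC.mem_expI hS hC.pi hE hθ).2
    rwa [Complex.exp_ofReal_mul_I_im] at hm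

/-- `θ₁(q) = π ℓ_q (1/a) / 2`. [cite: Moore1966, Ch. 3 (interval arithmetic: inclusion property)] -/
def theta1Box (prm : Params) (C : Consts) (q : ℕ) : MI := ((C.P.mul prm.S (C.lens.getD q default)).mul prm.S C.invA).divNat 2

/-- `θ∓(q,q') = (π ℓ_q/a ∓ π ℓ_{q'}/a)/2` (`sub = true`: minus). [cite: Moore1966, Ch. 3 (interval arithmetic: inclusion property)] -/
def theta2Box (prm : Params) (C : Consts) (sub : Bool) (q q' : ℕ) : MI :=
  let u := (C.P.mul prm.S (C.lens.getD q default)).mul prm.S C.invA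
  let v := (C.P.mul prm.S (C.lens.getD q' default)).mul prm.S C.invA
  (if sub then u.sub v else u.add v).divNat 2

/-- [cite: Moore1966, Ch. 3 (interval arithmetic: inclusion property)] -/
theorem mem_theta1Box {prm : Params} (hS : 0 < prm.S) (hC : ConstsValid prm.S a ks C) {q : ℕ} (hq : q < ks.length) :
    MI.mem prm.S (π * (ks.getD q default).len / a / 2) (theta1Box prm C q) := by
  unfold theta1Box
  have h := MI.mem_divNat (MI.mem_mul hS (MI.mem_mul hS hC.pi (hC.lens q hq)) hC.invA) (n := 2) (by norm_num)
  refine mem_of_eq h ?_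
  push_cast; ring

/-- [cite: Moore1966, Ch. 3 (interval arithmetic: inclusion property)] -/
theorem mem_theta2Box {prm : Params} (hS : 0 < prm.S) (hC : ConstsValid prm.S a ks C) (sub : Bool) {q q' : ℕ}
    (hq : q < ks.length) (hq' : q' < ks.length) :
    MI.mem prm.S ((π * (ks.getD q default).len / a + (if sub then -1 else 1) * (π * (ks.getD q' default).len / a)) / 2)
      (theta2Box prm C sub q q') := by
  unfold theta2Box
  have hu := MI.mem_mul hS (MI.mem_mul hS hC.pi (hC.lens q hq)) hC.invA
  have hv := MI.mem_mul hS (MI.mem_mul hS hC.pi (hC.lens q' hq')) hC.invA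
  cases sub with
  | true =>
    have h := MI.mem_divNat (MI.mem_sub hu hv) (n := 2) (by norm_num)
    refine mem_of_eq h ?_
    simp only [if_true]; push_cast; ring
  | false =>
    have h := MI.mem_divNat (MI.mem_add hu hv) (n := 2) (by norm_num)
    refine mem_of_eq h ?_
    simp only [Bool.false_eq_true, if_false]; push_cast; ring

/-- Kernel check of ALL sine data against the window's prime data (`sd1` one-variable, `sdm` minus pairs, `sdp` plus pairs).
[cite: Moore1966, Ch. 3 (interval arithmetic: inclusion property)] -/
def checkSines (prm : Params) (C : Consts) (ks : List PrimeLen) (cs : ℕ) (sd1 : List ℕ) (sdm sdp : List (List ℕ)) : Bool :=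
  (List.range ks.length).all fun q ↦
    let k := (ks.getD q default).val
    (match sinBox prm C (theta1Box prm C q) with
      | some Y => sineDatumOK prm.S cs (sd1.getD k 0) Y
      | none => decide (sd1.getD k 0 = 0)) &&
    (List.range ks.length).all fun q' ↦
      let k' := (ks.getD q' default).val
      (match sinBox prm C (theta2Box prm C true q q') with
        | some Y => sineDatumOK prm.S cs ((sdm.getD k []).getD k' 0) Y
        | none => decide ((sdm.getD k []).getD k' 0 = 0)) &&
      (match sinBox prm C (theta2Box prm C false q q') with
        | some Y => sineDatumOK prm.S cs ((sdp.getD k []).getD k' 0) Y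
        | none => decide ((sdp.getD k []).getD k' 0 = 0))

/-- A prime power of the window is a listed one: its index. [cite: Yoshida1992HermitianForms, §5 (5.15) p. 301] -/
theorem exists_index_of_mem (hks : PrimeData a ks) {k : ℕ} (hk : k ∈ weilPrimeIndex a) (hpp : IsPrimePow k) :
    ∃ q < ks.length, (ks.getD q default).val = k := by
  have h := (hks.mem_iff k hpp).1 hk
  obtain ⟨x, hx, rfl⟩ := List.mem_map.1 h
  obtain ⟨q, hq, rfl⟩ := List.getElem_of_mem hx
  exact ⟨q, hq, by rw [List.getD_eq_getElem?_getD, List.getElem?_eq_getElem hq, Option.getD_some]⟩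

/-- **Soundness of `checkSines`**: the three door hypotheses for the value-indexed data. [cite: Yoshida1992HermitianForms, §7 pp. 305–312] -/
theorem sines_of_check {prm : Params} (hS : 0 < prm.S) (hks : PrimeData a ks) (hC : ConstsValid prm.S a ks C)
    {cs : ℕ} {sd1 : List ℕ} {sdm sdp : List (List ℕ)} (h : checkSines prm C ks cs sd1 sdm sdp = true) :
    (∀ k ∈ weilPrimeIndex a, IsPrimePow k → 0 ≤ sFun sd1 cs k ∧ sFun sd1 cs k ≤ |Real.sin (π * Real.log k / a / 2)|) ∧
    (∀ k ∈ weilPrimeIndex a, ∀ k' ∈ weilPrimeIndex a, IsPrimePow k → IsPrimePow k' → k ≠ k' →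
      0 ≤ sFun2 sdm cs k k' ∧ sFun2 sdm cs k k' ≤ |Real.sin ((π * Real.log k / a - π * Real.log k' / a) / 2)|) ∧
    (∀ k ∈ weilPrimeIndex a, ∀ k' ∈ weilPrimeIndex a, IsPrimePow k → IsPrimePow k' →
      0 ≤ sFun2 sdp cs k k' ∧ sFun2 sdp cs k k' ≤ |Real.sin ((π * Real.log k / a + π * Real.log k' / a) / 2)|) := by
  simp only [checkSines, List.all_eq_true, List.mem_range, Bool.and_eq_true] at h
  have zero_case : ∀ {z : ℕ} {x : ℝ}, z = 0 → 0 ≤ ((z : ℕ) : ℝ) * (1 / 2 ^ cs) ∧ ((z : ℕ) : ℝ) * (1 / 2 ^ cs) ≤ |x| :=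
    fun hz ↦ by subst hz; simp
  refine ⟨fun k hk hpp ↦ ?_, fun k hk k' hk' hpp hpp' _ ↦ ?_, fun k hk k' hk' hpp hpp' ↦ ?_⟩
  · obtain ⟨q, hq, rfl⟩ := exists_index_of_mem hks hk hpp
    have h1 := (h q hq).1
    rw [PrimeLen.log_val]
    unfold sFun
    split at h1
    · rename_i Y hY
      exact sineDatum_le hS (mem_sinBox hS hC (mem_theta1Box hS hC hq) hY) h1
    · exact zero_case (of_decide_eq_true h1)
  · obtain ⟨q, hq, rfl⟩ := exists_index_of_mem hks hk hpp
    obtain ⟨q', hq', rfl⟩ := exists_index_of_mem hks hk' hpp'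
    have h2 := ((h q hq).2 q' hq').1
    rw [PrimeLen.log_val, PrimeLen.log_val]
    unfold sFun2
    split at h2
    · rename_i Y hY
      have hm := mem_sinBox hS hC (mem_theta2Box hS hC true hq hq') hY
      simp only [if_true] at hm
      have e : (π * (ks.getD q default).len / a + -1 * (π * (ks.getD q' default).len / a)) / 2
          = (π * (ks.getD q default).len / a - π * (ks.getD q' default).len / a) / 2 := by ring
      rw [e] at hm
      exact sineDatum_le hS hm h2
    · exact zero_case (of_decide_eq_true h2)
  · obtain ⟨q, hq, rfl⟩ := exists_index_of_mem hks hk hpp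
    obtain ⟨q', hq', rfl⟩ := exists_index_of_mem hks hk' hpp'
    have h3 := ((h q hq).2 q' hq').2
    rw [PrimeLen.log_val, PrimeLen.log_val]
    unfold sFun2
    split at h3
    · rename_i Y hY
      have hm := mem_sinBox hS hC (mem_theta2Box hS hC false hq hq') hY
      simp only [Bool.false_eq_true, if_false, one_mul] at hm
      exact sineDatum_le hS hm h3
    · exact zero_case (of_decide_eq_true h3)

end Encl

end Literature.NumberTheory.LFunctions.Yoshida1992
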